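import Literature.NumberTheory.Transcendental.OnePeriodsClosedPathsProofs
import Literature.NumberTheory.Transcendental.LindemannWeierstrassProofs
import Literature.Analysis.Complex.WindingNumberIntegral
import HarnessLib

/-!
# Complete periods of plane curves: the `𝔾_m` slice of Huber–Wüstholz, Cor. 13.13, is a theorem

Companion of `Literature/NumberTheory/Transcendental/OnePeriodsClosedPaths.lean` (the named fact
`Literature.NumberTheory.Transcendental.completePlaneCurvePeriods_zero_or_transcendental`:
complete periods `S = Σᵢ nᵢ ∮_{γᵢ} (A dx + B dy)` of polynomial `1`-forms over `ℚ` along closed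
`C¹` loops in the smooth locus of a plane curve `p = 0` over `ℚ` are `0` or transcendental;
Huber–Wüstholz, *Transcendence and Linear Relations of 1-Periods*, Cambridge Tracts 227 (2022),
Cor. 13.13, p. 126 of the held text) and of `OnePeriodsClosedPathsProofs.lean` (the elementary
half of the printed proof and the non-vacuity witness `∮ y dx = 2πi` on the hyperbola).

Here the named fact is PROVED outright for the one curve `p = xy − 1` (the multiplicative group
`𝔾_m`; smooth everywhere), for all forms, loops and multiplicities
(`completePlaneCurvePeriods_zero_or_transcendental_hyperbola`). This is the genus-`0` instance
"transcendence of `π`" of Huber–Wüstholz's Thm. 13.9 / Cor. 13.13 (their Remark 13.10), and the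
only instance whose transcendence input is available in the tree: Lindemann's theorem
(`Literature.NumberTheory.Transcendental.transcendental_pi_holds`, from the Lindemann–Weierstrass
file). For other rational components the same argument works in principle (complete periods are
`2πi` times `ℚ̄`-combinations of residues, so Lindemann suffices) but needs a rational
parametrisation and the residue theorem on a punctured sphere, available here only for `ℂ*`;
components of positive genus need Schneider's theorem on abelian integrals and, for the mixed
periods that closed loops on affine curves produce, Wüstholz's Analytic Subgroup Theorem — so the
general fact stays a named fact.

## The argument (residues on `ℂ*`, winding numbers, Lindemann)

For a closed `C¹` loop `γ = (x, y)` of period `1` on `xy = 1` one has `y = x⁻¹`, `x(t) ≠ 0` and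
`y′ = −x⁻² x′` (`hyperbola_inv_eq`, `hyperbola_deriv_snd`); a monomial `a xⁱ yʲ` restricts to the
Laurent monomial `a x^{i−j}` (`aeval_monomial_hyperbola`). Along a loop in `ℂ*`,
`∮ x^m dx = 0` for `m ≠ −1` (exactness, `integral_zpow_mul_deriv_eq_zero`) and
`∮ x⁻¹ dx = 2πi · wind(x)` (`integral_zpow_neg_one_mul_deriv`, from
`Literature.Analysis.Complex.integral_deriv_div_eq_wind_mul_of_contDiff`: the analytic winding
number is the topological one of `Literature.Topology.PlaneTopology.wind`). Summing over the
monomials of `A` and `B` (`MvPolynomial.induction_on'`), `∮_γ (A dx + B dy) = q · 2πi` with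
`q ∈ ℚ` (`exists_rat_completePeriod_hyperbola`; `q = wind(x) · Res₀`), hence
`S = Σᵢ nᵢ ∮_{γᵢ} ω ∈ ℚ · 2πi`; and `q · 2πi` with `q ∈ ℚ ∖ {0}` is transcendental because `π` is
(`rat_eq_zero_of_isAlgebraic_mul_two_pi_I`: `π² = −(q·2πi)²/(4q²)` would be algebraic).

## References

* A. Huber, G. Wüstholz, *Transcendence and Linear Relations of 1-Periods*, Cambridge Tracts in
  Mathematics 227, CUP 2022, doi:10.1017/9781009019729 [HuberWustholz2022]: Cor. 13.13 (p. 126),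
  Thm. 13.9 and Remark 13.10 (p. 125).
* F. Lindemann, *Über die Zahl π*, Math. Ann. 20 (1882) [Lindemann1882]; A. Baker,
  *Transcendental Number Theory* (1975), Ch. 1, Thm. 1.3 [BakerTNT1975].
-/

noncomputable section

open MvPolynomial Complex
open scoped Real

namespace Literature.NumberTheory.Transcendental

namespace ClosedPathPeriods

open Literature.Topology.PlaneTopology Literature.Analysis.Complex

variable {x : ℝ → ℂ}

/-! ### Laurent monomial forms `x^m dx` along a loop in `ℂ*` -/

/-- **`∮ x^m dx = 0` for `m ≠ −1`** along a nowhere-vanishing `C¹` loop `x : ℝ → ℂ*` of period `1`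
(`x^m dx = d(x^{m+1}/(m+1))` is exact on `ℂ*`). [folklore] -/
theorem integral_zpow_mul_deriv_eq_zero (hx : ContDiff ℝ 1 x) (h0 : ∀ t, x t ≠ 0)
    (h01 : x 0 = x 1) {m : ℤ} (hm : m ≠ -1) :
    (∫ t in (0:ℝ)..1, x t ^ m * deriv x t) = 0 := by
  have hm1 : ((m + 1 : ℤ) : ℂ) ≠ 0 := by
    exact_mod_cast fun h => hm (by omega)
  have hxd : ∀ t, HasDerivAt x (deriv x t) t := fun t =>
    ((hx.differentiable one_ne_zero) t).hasDerivAt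
  -- `d/dt x^{m+1} = (m+1) x^m x'`
  have hprim : ∀ t, HasDerivAt (fun s => x s ^ (m + 1))
      (((m + 1 : ℤ) : ℂ) * (x t ^ m * deriv x t)) t := by
    intro t
    have h := (hasDerivAt_zpow (m + 1) (x t) (Or.inl (h0 t))).comp t (hxd t)
    have e : ((m + 1 : ℤ) : ℂ) * x t ^ (m + 1 - 1) * deriv x t =
        ((m + 1 : ℤ) : ℂ) * (x t ^ m * deriv x t) := by
      rw [add_sub_cancel_right, mul_assoc]
    rwa [e] at h
  have hcont : Continuous fun t => x t ^ m * deriv x t :=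
    ((hx.continuous.zpow₀ m) fun t => Or.inl (h0 t)).mul (hx.continuous_deriv le_rfl)
  have hint : (∫ t in (0:ℝ)..1, ((m + 1 : ℤ) : ℂ) * (x t ^ m * deriv x t)) =
      x 1 ^ (m + 1) - x 0 ^ (m + 1) :=
    intervalIntegral.integral_eq_sub_of_hasDerivAt (fun t _ => hprim t)
      ((continuous_const.mul hcont).intervalIntegrable 0 1)
  rw [intervalIntegral.integral_const_mul, h01, sub_self, mul_eq_zero] at hint
  exact hint.resolve_left hm1

/-- **`∮ x⁻¹ dx = 2πi · wind x`** along a nowhere-vanishing `C¹` loop `x : ℝ → ℂ*` of period `1`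
(`Literature.Analysis.Complex.integral_deriv_div_eq_wind_mul_of_contDiff`, rewritten with
`x⁻¹ = x ^ (−1)`). [folklore] -/
theorem integral_zpow_neg_one_mul_deriv (hx : ContDiff ℝ 1 x) (h0 : ∀ t, x t ≠ 0)
    (h01 : x 0 = x 1) :
    (∫ t in (0:ℝ)..1, x t ^ (-1 : ℤ) * deriv x t) = wind x * (2 * π * I) := by
  rw [← integral_deriv_div_eq_wind_mul_of_contDiff hx h0 h01]
  refine intervalIntegral.integral_congr fun t _ => ?_
  simp only [zpow_neg, zpow_one]
  rw [div_eq_inv_mul]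

/-- **`∮ x^m dx ∈ ℚ · 2πi`**: for every `m ∈ ℤ` there is `q ∈ ℚ` (`q = wind x` if `m = −1`, else
`q = 0`) with `∮ x^m dx = q · 2πi`. [folklore] -/
theorem exists_rat_integral_zpow_mul_deriv (hx : ContDiff ℝ 1 x) (h0 : ∀ t, x t ≠ 0)
    (h01 : x 0 = x 1) (m : ℤ) :
    ∃ q : ℚ, (∫ t in (0:ℝ)..1, x t ^ m * deriv x t) = algebraMap ℚ ℂ q * (2 * π * I) := by
  by_cases hm : m = -1
  · subst hm
    refine ⟨wind x, ?_⟩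
    rw [integral_zpow_neg_one_mul_deriv hx h0 h01, map_intCast]
  · exact ⟨0, by rw [integral_zpow_mul_deriv_eq_zero hx h0 h01 hm, map_zero, zero_mul]⟩

/-! ### Loops on the hyperbola `xy = 1` -/

section Hyperbola

variable {γ : ℝ → (Fin 2 → ℂ)}

/-- On the hyperbola, `y = x⁻¹` and `x ≠ 0`. [folklore] -/
theorem hyperbola_inv_eq (h : ∀ t, γ t 0 * γ t 1 = 1) (t : ℝ) :
    γ t 0 ≠ 0 ∧ (γ t 0)⁻¹ = γ t 1 :=
  ⟨left_ne_zero_of_mul_eq_one (h t), inv_eq_of_mul_eq_one_right (h t)⟩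

/-- On the hyperbola, `y′ = −x′/x² = −x⁻² x′`. [folklore] -/
theorem hyperbola_deriv_snd (hγ : ContDiff ℝ 1 γ) (h : ∀ t, γ t 0 * γ t 1 = 1) (t : ℝ) :
    deriv (fun s => γ s 1) t = -(γ t 0 ^ (-2 : ℤ) * deriv (fun s => γ s 0) t) := by
  have hx0 : ∀ s, γ s 0 ≠ 0 := fun s => (hyperbola_inv_eq h s).1
  have hfun : (fun s => γ s 1) = fun s => (γ s 0)⁻¹ := funext fun s => (hyperbola_inv_eq h s).2.symm
  have hd : HasDerivAt (fun s => (γ s 0)⁻¹) (-(deriv (fun s => γ s 0) t) / (γ t 0) ^ 2) t :=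
    (hasDerivAt_apply_of_contDiff hγ 0 t).inv (hx0 t)
  rw [hfun, hd.deriv, zpow_neg, zpow_two, div_eq_mul_inv]
  ring

/-- A monomial `a xⁱ yʲ` restricted to the hyperbola is the Laurent monomial `a x^{i−j}`.
[folklore] -/
theorem aeval_monomial_hyperbola (h : ∀ t, γ t 0 * γ t 1 = 1) (d : Fin 2 →₀ ℕ) (a : ℚ) (t : ℝ) :
    aeval (γ t) (monomial d a) = algebraMap ℚ ℂ a * γ t 0 ^ ((d 0 : ℤ) - d 1) := by
  obtain ⟨hx0, hinv⟩ := hyperbola_inv_eq h t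
  rw [aeval_monomial, Finsupp.prod_fintype _ _ (fun i => by simp), Fin.prod_univ_two, ← hinv,
    inv_pow, ← zpow_natCast, ← zpow_natCast, ← zpow_neg, ← zpow_add₀ hx0, sub_eq_add_neg]

/-- The integrands `Q(γ(t)) · γⱼ′(t)` are interval integrable (continuous). [folklore] -/
theorem intervalIntegrable_aeval_mul_deriv (hγ : ContDiff ℝ 1 γ) (Q : MvPolynomial (Fin 2) ℚ)
    (j : Fin 2) (a b : ℝ) :
    IntervalIntegrable (fun t => aeval (γ t) Q * deriv (fun s => γ s j) t) MeasureTheory.volume a b :=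
  (Continuous.mul (continuous_aeval_comp_of_contDiff hγ Q)
    (continuous_deriv_apply_of_contDiff hγ j)).intervalIntegrable a b

/-- **`∮_γ A dx ∈ ℚ · 2πi`** for a polynomial `A ∈ ℚ[x, y]` and a closed `C¹` loop `γ` on the
hyperbola `xy = 1`. [folklore] -/
theorem exists_rat_integral_aeval_mul_deriv_fst (hγ : ContDiff ℝ 1 γ)
    (hper : Function.Periodic γ 1) (h : ∀ t, γ t 0 * γ t 1 = 1) (A : MvPolynomial (Fin 2) ℚ) :
    ∃ q : ℚ, (∫ t in (0:ℝ)..1, aeval (γ t) A * deriv (fun s => γ s 0) t) =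
      algebraMap ℚ ℂ q * (2 * π * I) := by
  have hx : ContDiff ℝ 1 fun s => γ s 0 := contDiff_pi.1 hγ 0
  have hx0 : ∀ s, γ s 0 ≠ 0 := fun s => (hyperbola_inv_eq h s).1
  have h01 : γ 0 0 = γ 1 0 := by
    have := hper 0
    rw [zero_add] at this
    exact (congrFun this 0).symm
  induction A using MvPolynomial.induction_on' with
  | monomial d a =>
    obtain ⟨q, hq⟩ := exists_rat_integral_zpow_mul_deriv hx hx0 h01 ((d 0 : ℤ) - d 1)
    refine ⟨a * q, ?_⟩
    simp_rw [aeval_monomial_hyperbola h d a, mul_assoc]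
    rw [intervalIntegral.integral_const_mul, hq, map_mul]
    ring
  | add p q hp hq =>
    obtain ⟨a, ha⟩ := hp
    obtain ⟨b, hb⟩ := hq
    refine ⟨a + b, ?_⟩
    simp_rw [map_add, add_mul]
    rw [intervalIntegral.integral_add (intervalIntegrable_aeval_mul_deriv hγ p 0 0 1)
      (intervalIntegrable_aeval_mul_deriv hγ q 0 0 1), ha, hb]

/-- **`∮_γ B dy ∈ ℚ · 2πi`** for a polynomial `B ∈ ℚ[x, y]` and a closed `C¹` loop `γ` on the
hyperbola `xy = 1` (`dy = −x⁻² dx` there). [folklore] -/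
theorem exists_rat_integral_aeval_mul_deriv_snd (hγ : ContDiff ℝ 1 γ)
    (hper : Function.Periodic γ 1) (h : ∀ t, γ t 0 * γ t 1 = 1) (B : MvPolynomial (Fin 2) ℚ) :
    ∃ q : ℚ, (∫ t in (0:ℝ)..1, aeval (γ t) B * deriv (fun s => γ s 1) t) =
      algebraMap ℚ ℂ q * (2 * π * I) := by
  have hx : ContDiff ℝ 1 fun s => γ s 0 := contDiff_pi.1 hγ 0
  have hx0 : ∀ s, γ s 0 ≠ 0 := fun s => (hyperbola_inv_eq h s).1
  have h01 : γ 0 0 = γ 1 0 := by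
    have := hper 0
    rw [zero_add] at this
    exact (congrFun this 0).symm
  induction B using MvPolynomial.induction_on' with
  | monomial d b =>
    obtain ⟨q, hq⟩ := exists_rat_integral_zpow_mul_deriv hx hx0 h01 ((d 0 : ℤ) - d 1 + (-2))
    refine ⟨-(b * q), ?_⟩
    have e : ∀ t, aeval (γ t) (monomial d b) * deriv (fun s => γ s 1) t =
        -(algebraMap ℚ ℂ b) * (γ t 0 ^ ((d 0 : ℤ) - d 1 + (-2)) * deriv (fun s => γ s 0) t) := by
      intro t
      rw [aeval_monomial_hyperbola h d b, hyperbola_deriv_snd hγ h t, zpow_add₀ (hx0 t)]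
      ring
    simp_rw [e]
    rw [intervalIntegral.integral_const_mul, hq, map_neg, map_mul]
    ring
  | add p q hp hq =>
    obtain ⟨a, ha⟩ := hp
    obtain ⟨b, hb⟩ := hq
    refine ⟨a + b, ?_⟩
    simp_rw [map_add, add_mul]
    rw [intervalIntegral.integral_add (intervalIntegrable_aeval_mul_deriv hγ p 1 0 1)
      (intervalIntegrable_aeval_mul_deriv hγ q 1 0 1), ha, hb]

/-- **Complete periods on the hyperbola are rational multiples of `2πi`**: for `A, B ∈ ℚ[x, y]`
and a closed `C¹` loop `γ` of period `1` on `xy = 1`,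
`∮_γ (A dx + B dy) = q · 2πi` with `q ∈ ℚ` (`q = wind(x) · Res₀`, the residue of the Laurent
form `(A(x, x⁻¹) − x⁻² B(x, x⁻¹)) dx`). [folklore] -/
theorem exists_rat_completePeriod_hyperbola (hγ : ContDiff ℝ 1 γ)
    (hper : Function.Periodic γ 1) (h : ∀ t, γ t 0 * γ t 1 = 1) (A B : MvPolynomial (Fin 2) ℚ) :
    ∃ q : ℚ, (∫ t in (0:ℝ)..1, (aeval (γ t) A * deriv (fun s => γ s 0) t +
        aeval (γ t) B * deriv (fun s => γ s 1) t)) = algebraMap ℚ ℂ q * (2 * π * I) := by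
  obtain ⟨a, ha⟩ := exists_rat_integral_aeval_mul_deriv_fst hγ hper h A
  obtain ⟨b, hb⟩ := exists_rat_integral_aeval_mul_deriv_snd hγ hper h B
  refine ⟨a + b, ?_⟩
  rw [intervalIntegral.integral_add (intervalIntegrable_aeval_mul_deriv hγ A 0 0 1)
      (intervalIntegrable_aeval_mul_deriv hγ B 1 0 1), ha, hb, map_add, add_mul]

end Hyperbola

/-- A rational multiple `q · 2πi` of `2πi` is algebraic only if `q = 0` (Lindemann:
`π` is transcendental, `transcendental_pi_holds`). [cite: Lindemann1882, via BakerTNT1975 Ch. 1 Theorem 1.3, p. 5] -/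
theorem rat_eq_zero_of_isAlgebraic_mul_two_pi_I {q : ℚ}
    (halg : IsAlgebraic ℚ (algebraMap ℚ ℂ q * (2 * π * I))) : q = 0 := by
  by_contra hq
  -- `π² = −(q·2πi)² / (4q²)` is algebraic, hence so is `π`
  set S : ℂ := algebraMap ℚ ℂ q * (2 * π * I) with hS
  have hI2 : (I : ℂ) ^ 2 = -1 := I_sq
  have hq' : (algebraMap ℚ ℂ q) ≠ 0 := by
    rwa [Ne, map_eq_zero_iff _ (algebraMap ℚ ℂ).injective]
  have hpi : (π : ℂ) ^ 2 = S ^ 2 * algebraMap ℚ ℂ (-(1 / (4 * q ^ 2))) := by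
    rw [hS, map_neg, map_div₀, map_one, map_mul, map_pow, map_ofNat]
    field_simp
    rw [hI2]
    ring
  have halg2 : IsAlgebraic ℚ ((π : ℂ) ^ 2) := by
    rw [hpi]
    exact (halg.pow 2).mul (isAlgebraic_algebraMap _)
  have halgπ : IsAlgebraic ℚ (π : ℂ) := IsAlgebraic.of_pow two_pos halg2
  have halgπ' : IsAlgebraic ℚ Real.pi := by
    rw [← Complex.coe_algebraMap] at halgπ
    exact (isAlgebraic_algebraMap_iff Complex.ofReal_injective).mp halgπ
  exact transcendental_pi_holds halgπ'

end ClosedPathPeriods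

/-- **The `𝔾_m` slice of the named fact is a theorem**: `completePlaneCurvePeriods_zero_or_transcendental`
holds for the hyperbola `p = xy − 1` (the curve `𝔾_m`, smooth everywhere), unconditionally: for
`A, B ∈ ℚ[x, y]`, closed `C¹` loops `γᵢ` of period `1` on `xy = 1` and `nᵢ ∈ ℤ`, the complete
period `S = Σᵢ nᵢ ∮_{γᵢ} (A dx + B dy)` is a rational multiple of `2πi`
(`S = 2πi · Res₀ · Σᵢ nᵢ wind(xᵢ)`, residues of `x^m dx` on `ℂ*`), so it vanishes as soon as it is
algebraic, by Lindemann's theorem (`transcendental_pi_holds`). This is the genus-`0` instance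
"transcendence of `π`" of Huber–Wüstholz, Thm. 13.9 / Cor. 13.13 (Remark 13.10); the general fact
needs the Analytic Subgroup Theorem and stays a named fact.
[cite: HuberWustholz2022, Cor. 13.13 (p. 126) and Remark 13.10 (p. 125)] -/
theorem completePlaneCurvePeriods_zero_or_transcendental_hyperbola (A B : MvPolynomial (Fin 2) ℚ)
    (k : ℕ) (n : Fin k → ℤ) (γ : Fin k → ℝ → (Fin 2 → ℂ))
    (hγ : ∀ i, ContDiff ℝ 1 (γ i) ∧ Function.Periodic (γ i) 1 ∧
      ∀ t, aeval (γ i t) (X 0 * X 1 - 1 : MvPolynomial (Fin 2) ℚ) = 0 ∧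
        ∃ j, aeval (γ i t) (pderiv j (X 0 * X 1 - 1 : MvPolynomial (Fin 2) ℚ)) ≠ 0)
    (halg : IsAlgebraic ℚ (∑ i, (n i : ℂ) * ∫ t in (0:ℝ)..1,
      (aeval (γ i t) A * deriv (fun s => γ i s 0) t +
        aeval (γ i t) B * deriv (fun s => γ i s 1) t))) :
    (∑ i, (n i : ℂ) * ∫ t in (0:ℝ)..1,
      (aeval (γ i t) A * deriv (fun s => γ i s 0) t +
        aeval (γ i t) B * deriv (fun s => γ i s 1) t)) = 0 := by
  have hon : ∀ i t, γ i t 0 * γ i t 1 = 1 := fun i t => by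
    have h := ((hγ i).2.2 t).1
    simp only [map_sub, map_mul, aeval_X, map_one] at h
    exact sub_eq_zero.1 h
  -- each loop contributes a rational multiple of `2πi`
  have hq : ∀ i, ∃ q : ℚ, (∫ t in (0:ℝ)..1, (aeval (γ i t) A * deriv (fun s => γ i s 0) t +
      aeval (γ i t) B * deriv (fun s => γ i s 1) t)) = algebraMap ℚ ℂ q * (2 * π * I) := fun i =>
    ClosedPathPeriods.exists_rat_completePeriod_hyperbola (hγ i).1 (hγ i).2.1 (hon i) A B
  choose q hq using hq
  have hS : (∑ i, (n i : ℂ) * ∫ t in (0:ℝ)..1, (aeval (γ i t) A * deriv (fun s => γ i s 0) t +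
      aeval (γ i t) B * deriv (fun s => γ i s 1) t)) =
      algebraMap ℚ ℂ (∑ i, n i * q i) * (2 * π * I) := by
    rw [map_sum, Finset.sum_mul]
    refine Finset.sum_congr rfl fun i _ => ?_
    rw [hq i, map_mul, map_intCast]
    ring
  rw [hS] at halg ⊢
  rw [ClosedPathPeriods.rat_eq_zero_of_isAlgebraic_mul_two_pi_I halg, map_zero, zero_mul]

end Literature.NumberTheory.Transcendental

end
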